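import Literature.AlgebraicGeometry.RelativeSpec.GeometricQuotientFreeFlat
import Literature.RingTheory.GaloisAlgebras.ChaseHarrisonRosenbergEtale
import Mathlib.AlgebraicGeometry.Morphisms.Etale
import HarnessLib

/-!
# An affine geometric quotient by a free finite group action is finite étale and surjective
# (SGA 1, Exp. V, Cor. 2.4 / Prop. 2.6: a free quotient is an étale `G`-torsor)

Continuation of `RelativeSpec/GeometricQuotientFreeFlat` (`isFinite_of_free`, `flat_of_free`) in the
intrinsic currency `ActionOver.IsGeometricQuotient` (Mumford's (1), (2); any `p : X → Q`, e.g. the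
tree's `X → X/G` or a `finiteQuotient.mk`): if the action of the finite group `G` is FREE on the
affine charts (Chase–Harrison–Rosenberg condition: for `g ≠ 1` the `g·b − b` generate the unit ideal
of `Γ(X, p⁻¹V)`), then `Γ(Q, V) ⊆ Γ(X, p⁻¹V)` is a `G`-Galois extension of rings, hence étale
(★ `GaloisAlgebras.etale_of_free`: torsor isomorphism `B ⊗_A B ≅ ∏_G B` + étale descent along the
faithfully flat `A → B`), and étaleness is affine-local on the target:

* `IsGeometricQuotient.etale_app_of_free` — `Γ(Q, V) → Γ(X, p⁻¹V)` is étale on a free chart;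
* `IsGeometricQuotient.etale_of_free` — **`p` is étale**;
* `IsGeometricQuotient.isFinite_etale_surjective_of_free` — `p` is finite, étale and surjective: an
  étale `G`-torsor («revêtement principal de groupe `G`», SGA 1 V Déf. 2.7), the intrinsic form of
  ★ `ActionOver.isFinite_and_etale_toQuotient` (`RelativeSpec/FreeQuotientEtale`, tree quotient only).

Everything is proved; no named facts, no definitions.

Mathlib searched (pin): `HasRingHomProperty @Etale RingHom.Etale`, `RingHom.Etale.respectsIso`,
`RingHom.Etale.propertyIsLocal`, `RingHom.etale_algebraMap`, `targetAffineLocally_affineAnd_iff'`,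
`targetAffineLocally_affineAnd_iff_affineLocally`, `HasRingHomProperty.eq_affineLocally` (all used).

## References

* A. Grothendieck, *SGA 1*, Exp. V, Cor. 2.4, Prop. 2.6, Déf. 2.7. [SGA1]
* D. Mumford, *Abelian Varieties* (1970), §7 Thm. p. 66; §12 Thm. 1 (p. 112). [MumfordAV1970]
* C. Greither, LNM 1534 (1992), Ch. 0, Thm. 1.6, Lemma 1.9. [Greither1992CyclicGalois]
-/

noncomputable section

universe u

open CategoryTheory Limits AlgebraicGeometry TopologicalSpace Opposite

namespace Literature.AlgebraicGeometry.RelativeSpec.ActionOver.IsGeometricQuotient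

variable {X Q : Scheme.{u}} {p : X ⟶ Q} {G : Type u} [Group G] {ρ : ActionOver p G}
variable [Fintype G] (hq : ρ.IsGeometricQuotient p)
include hq

/-- **On a free chart the quotient map is étale**: for `V ⊆ Q` with the free condition on
`Γ(X, p⁻¹V)`, the ring map `Γ(Q, V) → Γ(X, p⁻¹V)` is étale (the `G`-Galois extension
`Γ(Q, V) ⊆ Γ(X, p⁻¹V)` is étale: ★ `GaloisAlgebras.etale_of_free`).
[cite: SGA1, Exp. V Prop. 2.6] [cite: Greither1992CyclicGalois, Ch. 0 Thm. 1.6 (i), Lemma 1.9] -/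
theorem etale_app_of_free {V : Q.Opens}
    (hfreeV : ∀ g : G, g ≠ 1 →
      Ideal.span (Set.range fun b : Γ(X, p ⁻¹ᵁ V) ↦ ρ.act g V b - b) = ⊤) :
    (p.app V).hom.Etale := by
  letI : Algebra Γ(Q, V) Γ(X, p ⁻¹ᵁ V) := (p.app V).hom.toAlgebra
  letI : MulSemiringAction G Γ(X, p ⁻¹ᵁ V) := ρ.mulSemiringAction V
  haveI : SMulCommClass G Γ(Q, V) Γ(X, p ⁻¹ᵁ V) := ⟨fun g a b => by
    change ρ.act g V (p.app V a * b) = p.app V a * ρ.act g V b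
    rw [map_mul, ρ.act_app]⟩
  haveI : Algebra.IsInvariant Γ(Q, V) Γ(X, p ⁻¹ᵁ V) G :=
    ⟨fun b hb => hq.exists_app_eq V b fun g _ => hb g⟩
  haveI : FaithfulSMul Γ(Q, V) Γ(X, p ⁻¹ᵁ V) :=
    (faithfulSMul_iff_algebraMap_injective _ _).mpr (hq.app_injective V)
  have h : Algebra.Etale Γ(Q, V) Γ(X, p ⁻¹ᵁ V) :=
    Literature.RingTheory.GaloisAlgebras.etale_of_free Γ(Q, V) G hfreeV
  exact RingHom.etale_algebraMap.mpr h

variable [IsAffineHom p]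
  (hfree : ∀ (V : Q.Opens), IsAffineOpen V → ∀ g : G, g ≠ 1 →
    Ideal.span (Set.range fun b : Γ(X, p ⁻¹ᵁ V) ↦ ρ.act g V b - b) = ⊤)
include hfree

/-- **An affine geometric quotient by a free finite group action is étale** (SGA 1, Exp. V,
Cor. 2.4 / Prop. 2.6: the quotient map is étale at the points with trivial inertia; Mumford §7 / §12):
étaleness is affine-local on the target for the affine `p` (Mathlib `targetAffineLocally_affineAnd_iff'`
/ `…_iff_affineLocally` for `RingHom.Etale`) and holds on the charts by `etale_app_of_free`.
[cite: SGA1, Exp. V Cor. 2.4, Prop. 2.6] [cite: MumfordAV1970, §7 Thm. p. 66] -/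
theorem etale_of_free : Etale p := by
  have h1 : targetAffineLocally (affineAnd RingHom.Etale) p :=
    (targetAffineLocally_affineAnd_iff' RingHom.Etale.respectsIso p).mpr
      ⟨inferInstance, fun V hV => hq.etale_app_of_free (hfree V hV)⟩
  have h2 :=
    (targetAffineLocally_affineAnd_iff_affineLocally RingHom.Etale.propertyIsLocal p).mp h1
  rw [HasRingHomProperty.eq_affineLocally (P := @Etale)]
  exact h2.2

/-- **A free affine geometric quotient is an étale `G`-torsor**: `p` is finite, étale and surjective
(«revêtement principal de groupe `G`», SGA 1 V Déf. 2.7; ★ `isFinite_of_free`, `etale_of_free`,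
`IsGeometricQuotient.surjective`). [cite: SGA1, Exp. V Prop. 2.6, Déf. 2.7]
[cite: MumfordAV1970, §12 Thm. 1 (p. 112)] -/
theorem isFinite_etale_surjective_of_free : IsFinite p ∧ Etale p ∧ Surjective p :=
  ⟨hq.isFinite_of_free hfree, hq.etale_of_free hfree, ⟨hq.surjective⟩⟩

end Literature.AlgebraicGeometry.RelativeSpec.ActionOver.IsGeometricQuotient

end
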